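import Summits.AtomisticToContinuum.BoseEinsteinCondensation.Theorems.BECPeriodicReductionBoundaryTransferWeakResidual

/-!
# Birth skeleton (BC3) of piece X₁ `ModeFreeRewardChord` of the mode-free reward split of
# `BoundaryTransferWeak` (stmt-AtomisticToContinuum-0827)

The two-chord bound is split BY SCALE at the finite-size reward `κ/L_N²` (regime decomposition; each
regime owns a technique):

* `stub_gapScaleChord` — GAP-SCALE regime `0 < λ ≤ κ/L_N²` (finite-size spectral theory: the mode-free
  condensate number of the `λ`-rewarded ground state exceeds the unrewarded one by `≤ τN` for
  `λ ≤ κ/L_N²`; mechanism: second-order perturbation `δn ≤ λ·2Var(n̂)/gap` with NORMAL condensate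
  fluctuations `Var_{Ψ₀}(n̂_φ*) ≤ V N` at `T = 0` and a finite-size gap `≥ g₀/L_N²`, so `δn ≤ 2κV N/g₀`).
* `stub_bulkChord` — BULK regime `κ/L_N² ≤ λ ≤ λ₀` (thermodynamic-limit Bogoliubov theory of the
  rewarded, pseudo-Goldstone-GAPPED gas `H + λ(N − n̂_φ)`: `n(λ₀) − n(κ/L²) ≲ N (ρa³)^{1/2} (λ₀/μ) log(μ L²/κ)`-type
  bounds, i.e. an integrable condensate susceptibility above the finite-size scale).

Composition `ModeFreeRewardChord_of` (sorry-free): chords concatenate — `chord(λ) ≤ chord(κ/L²) + τN/2`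
and `chord(κ/L²) ≤ chord(λ₀) + τN/2` give `chord(λ) ≤ chord(λ₀) + τN` (`twoChord_concat`, the
`ℝ≥0∞ ↔ ℝ` bookkeeping with the `E₀ = ⊤` case vacuous). `sorry` occurs only inside the two `stub_*`.
-/

noncomputable section

open MeasureTheory Filter
open scoped ENNReal NNReal Topology

namespace Summit.AtomisticToContinuum.BoseEinsteinCondensation.ModeFreeReward.BirthX1

open Literature.MathematicalPhysics.QuantumManyBody.BoseGas

/-- The mode-free rewarded infimum `G_N(t) = inf_Ψ [⟨Ψ,HΨ⟩ + t (N − λ_max(γ_Ψ))]`. [folklore] -/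
def G (v : ℝ → ℝ≥0∞) (N : ℕ) (L : ℝ) (t : ℝ) : ℝ≥0∞ :=
  ⨅ Ψ : TrialState N L, energy v Ψ + ENNReal.ofReal t * ((N : ℝ≥0∞) - maxOccupation N Ψ.ψ)

/-- The additive `ℝ≥0∞` two-chord inequality between rewards `a ≤ b` with tolerance `τ`:
`G(a) + (a/b) E₀ ≤ E₀ + (a/b) G(b) + a τ N`. [folklore] -/
def TwoChord (v : ℝ → ℝ≥0∞) (N : ℕ) (L : ℝ) (a b τ : ℝ) : Prop :=
  G v N L a + ENNReal.ofReal (a / b) * groundStateEnergy v N L ≤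
    groundStateEnergy v N L + ENNReal.ofReal (a / b) * G v N L b + ENNReal.ofReal (a * τ * N)

/-! ### Elementary facts about `G` and `TwoChord` (proved) -/

/-- `E₀ ≤ G(t)` (the reward is non-negative). [folklore] -/
theorem groundStateEnergy_le_G (v : ℝ → ℝ≥0∞) (N : ℕ) (L : ℝ) (t : ℝ) :
    groundStateEnergy v N L ≤ G v N L t :=
  le_iInf fun Ψ => (groundStateEnergy_le_energy v Ψ).trans le_self_add

/-- `G(t) < ∞` as soon as `E₀ < ∞`. [folklore] -/
theorem G_ne_top {v : ℝ → ℝ≥0∞} {N : ℕ} {L : ℝ} (hE : groundStateEnergy v N L ≠ ⊤) (t : ℝ) :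
    G v N L t ≠ ⊤ := by
  have hlt : (⨅ Ψ : TrialState N L, energy v Ψ) < ⊤ := lt_top_iff_ne_top.2 hE
  obtain ⟨Ψ, hΨ⟩ := iInf_lt_iff.1 hlt
  refine ne_top_of_le_ne_top ?_ (iInf_le _ Ψ)
  refine ENNReal.add_ne_top.2 ⟨hΨ.ne, ENNReal.mul_ne_top ENNReal.ofReal_ne_top ?_⟩
  exact ne_top_of_le_ne_top (ENNReal.natCast_ne_top N) tsub_le_self

/-- Monotonicity of the two-chord inequality in the tolerance. [folklore] -/
theorem twoChord_mono_tau {v : ℝ → ℝ≥0∞} {N : ℕ} {L : ℝ} {a b τ₁ τ₂ : ℝ} (ha : 0 ≤ a)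
    (hτ : τ₁ ≤ τ₂) (h : TwoChord v N L a b τ₁) : TwoChord v N L a b τ₂ :=
  h.trans (add_le_add le_rfl (ENNReal.ofReal_le_ofReal
    (mul_le_mul_of_nonneg_right (mul_le_mul_of_nonneg_left hτ ha) (Nat.cast_nonneg N))))

/-- `toReal` of the two sides of a two-chord inequality. [folklore] -/
theorem toReal_sides {x E y : ℝ≥0∞} {r s : ℝ} (hx : x ≠ ⊤) (hE : E ≠ ⊤) (hy : y ≠ ⊤)
    (hr : 0 ≤ r) (hs : 0 ≤ s) :
    (x + ENNReal.ofReal r * E).toReal = x.toReal + r * E.toReal ∧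
      (E + ENNReal.ofReal r * y + ENNReal.ofReal s).toReal = E.toReal + r * y.toReal + s := by
  constructor
  · rw [ENNReal.toReal_add hx (ENNReal.mul_ne_top ENNReal.ofReal_ne_top hE), ENNReal.toReal_mul,
      ENNReal.toReal_ofReal hr]
  · rw [ENNReal.toReal_add (ENNReal.add_ne_top.2 ⟨hE, ENNReal.mul_ne_top ENNReal.ofReal_ne_top hy⟩)
        ENNReal.ofReal_ne_top,
      ENNReal.toReal_add hE (ENNReal.mul_ne_top ENNReal.ofReal_ne_top hy), ENNReal.toReal_mul,
      ENNReal.toReal_ofReal hr, ENNReal.toReal_ofReal hs]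

/-- **Chords concatenate**: `TwoChord a m τ₁` and `TwoChord m b τ₂` give `TwoChord a b (τ₁ + τ₂)` for
`0 < a ≤ m ≤ b` (real algebra: multiply the second by `a/m` and add; the `E₀ = ⊤` case is vacuous).
[folklore] -/
theorem twoChord_concat {v : ℝ → ℝ≥0∞} {N : ℕ} {L : ℝ} {a m b τ₁ τ₂ : ℝ} (ha : 0 < a) (ham : a ≤ m)
    (hmb : m ≤ b) (hτ₁ : 0 ≤ τ₁) (hτ₂ : 0 ≤ τ₂) (h1 : TwoChord v N L a m τ₁)
    (h2 : TwoChord v N L m b τ₂) : TwoChord v N L a b (τ₁ + τ₂) := by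
  unfold TwoChord at *
  set E₀ := groundStateEnergy v N L with hE₀def
  by_cases hE : E₀ = ⊤
  · calc G v N L a + ENNReal.ofReal (a / b) * E₀ ≤ ⊤ := le_top
      _ = E₀ + ENNReal.ofReal (a / b) * G v N L b + ENNReal.ofReal (a * (τ₁ + τ₂) * N) := by
          rw [hE, top_add, top_add]
  have hm : 0 < m := ha.trans_le ham
  have hb : 0 < b := hm.trans_le hmb
  have hGa := G_ne_top hE a
  have hGm := G_ne_top hE m
  have hGb := G_ne_top hE b
  have hN : (0 : ℝ) ≤ N := N.cast_nonneg
  have hr₁ : 0 ≤ a / m := div_nonneg ha.le hm.le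
  have hr₂ : 0 ≤ m / b := div_nonneg hm.le hb.le
  have hr : 0 ≤ a / b := div_nonneg ha.le hb.le
  -- to real numbers
  obtain ⟨l1, r1⟩ := toReal_sides (r := a / m) (s := a * τ₁ * N) hGa hE hGm hr₁ (by positivity)
  obtain ⟨l2, r2⟩ := toReal_sides (r := m / b) (s := m * τ₂ * N) hGm hE hGb hr₂ (by positivity)
  obtain ⟨l3, r3⟩ := toReal_sides (r := a / b) (s := a * (τ₁ + τ₂) * N) hGa hE hGb hr (by positivity)
  have hR1 : E₀ + ENNReal.ofReal (a / m) * G v N L m + ENNReal.ofReal (a * τ₁ * N) ≠ ⊤ :=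
    ENNReal.add_ne_top.2 ⟨ENNReal.add_ne_top.2 ⟨hE, ENNReal.mul_ne_top ENNReal.ofReal_ne_top hGm⟩,
      ENNReal.ofReal_ne_top⟩
  have hR2 : E₀ + ENNReal.ofReal (m / b) * G v N L b + ENNReal.ofReal (m * τ₂ * N) ≠ ⊤ :=
    ENNReal.add_ne_top.2 ⟨ENNReal.add_ne_top.2 ⟨hE, ENNReal.mul_ne_top ENNReal.ofReal_ne_top hGb⟩,
      ENNReal.ofReal_ne_top⟩
  have hL3 : G v N L a + ENNReal.ofReal (a / b) * E₀ ≠ ⊤ :=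
    ENNReal.add_ne_top.2 ⟨hGa, ENNReal.mul_ne_top ENNReal.ofReal_ne_top hE⟩
  have hR3 : E₀ + ENNReal.ofReal (a / b) * G v N L b + ENNReal.ofReal (a * (τ₁ + τ₂) * N) ≠ ⊤ :=
    ENNReal.add_ne_top.2 ⟨ENNReal.add_ne_top.2 ⟨hE, ENNReal.mul_ne_top ENNReal.ofReal_ne_top hGb⟩,
      ENNReal.ofReal_ne_top⟩
  have h1r : (G v N L a).toReal + a / m * E₀.toReal ≤
      E₀.toReal + a / m * (G v N L m).toReal + a * τ₁ * N := by
    have h := ENNReal.toReal_mono hR1 h1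
    rwa [l1, r1] at h
  have h2r : (G v N L m).toReal + m / b * E₀.toReal ≤
      E₀.toReal + m / b * (G v N L b).toReal + m * τ₂ * N := by
    have h := ENNReal.toReal_mono hR2 h2
    rwa [l2, r2] at h
  -- real algebra
  have e1 : a / m * (m / b) = a / b := by
    rw [div_mul_div_comm, mul_comm m b, ← div_mul_div_comm, div_self hm.ne', mul_one]
  have e2 : a / m * m = a := div_mul_cancel₀ a hm.ne'
  have h3 : a / m * ((G v N L m).toReal + m / b * E₀.toReal) ≤
      a / m * (E₀.toReal + m / b * (G v N L b).toReal + m * τ₂ * N) :=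
    mul_le_mul_of_nonneg_left h2r hr₁
  have h3' : a / m * (G v N L m).toReal + a / b * E₀.toReal ≤
      a / m * E₀.toReal + a / b * (G v N L b).toReal + a * τ₂ * N := by
    have x1 : a / m * ((G v N L m).toReal + m / b * E₀.toReal) =
        a / m * (G v N L m).toReal + (a / m * (m / b)) * E₀.toReal := by ring
    have x2 : a / m * (E₀.toReal + m / b * (G v N L b).toReal + m * τ₂ * N) =
        a / m * E₀.toReal + (a / m * (m / b)) * (G v N L b).toReal + (a / m * m) * τ₂ * N := by ring
    rw [x1, x2, e1, e2] at h3
    exact h3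
  have hreal : (G v N L a).toReal + a / b * E₀.toReal ≤
      E₀.toReal + a / b * (G v N L b).toReal + a * (τ₁ + τ₂) * N := by
    nlinarith [h1r, h3']
  -- back to `ℝ≥0∞`
  refine (ENNReal.toReal_le_toReal hL3 hR3).1 ?_
  rw [l3, r3]
  exact hreal

/-! ### The two registered stubs -/

/-- **Stub — gap-scale regime.** For every admissible `v`, below some density, for every `τ > 0` there is
`κ > 0` such that eventually in `N`, for all `0 < λ ≤ κ/L_N²`, `TwoChord λ (κ/L_N²) τ`: the mode-free
condensate gained by a gap-scale reward is `≤ τN` (variance/gap perturbation theory at finite size).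
[folklore] -/
theorem stub_gapScaleChord :
    ∀ v : ℝ → ℝ≥0∞, IsRepulsiveFiniteRange v → ∃ ρ₁ : ℝ, 0 < ρ₁ ∧ ∀ ρ : ℝ, 0 < ρ → ρ < ρ₁ →
      ∀ τ : ℝ, 0 < τ → ∃ κ : ℝ, 0 < κ ∧ ∀ᶠ N : ℕ in atTop, ∀ lam : ℝ, 0 < lam →
        lam ≤ κ / sideLength ρ N ^ 2 →
          TwoChord v N (sideLength ρ N) lam (κ / sideLength ρ N ^ 2) τ := by
  sorry

/-- **Stub — bulk regime.** For every admissible `v`, below some density, for every `τ > 0` and every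
`κ > 0` there is `λ₀ > 0` such that eventually in `N`, `κ/L_N² ≤ λ₀` and for all `κ/L_N² ≤ λ ≤ λ₀`,
`TwoChord λ λ₀ τ`: integrable condensate susceptibility of the rewarded (gapped) gas above the finite-size
scale (thermodynamic-limit Bogoliubov theory of `H + λ(N − n̂_φ)`). [folklore] -/
theorem stub_bulkChord :
    ∀ v : ℝ → ℝ≥0∞, IsRepulsiveFiniteRange v → ∃ ρ₁ : ℝ, 0 < ρ₁ ∧ ∀ ρ : ℝ, 0 < ρ → ρ < ρ₁ →
      ∀ τ : ℝ, 0 < τ → ∀ κ : ℝ, 0 < κ → ∃ lam₀ : ℝ, 0 < lam₀ ∧ ∀ᶠ N : ℕ in atTop,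
        κ / sideLength ρ N ^ 2 ≤ lam₀ ∧ ∀ lam : ℝ, κ / sideLength ρ N ^ 2 ≤ lam → lam ≤ lam₀ →
          TwoChord v N (sideLength ρ N) lam lam₀ τ := by
  sorry

/-! ### Composition: piece X₁ verbatim -/

/-- **Piece X₁ `ModeFreeRewardChord` (verbatim the filed statement) from the two scale stubs**, by
concatenation of chords across `κ/L_N²`. [folklore] -/
theorem ModeFreeRewardChord_of
    (hgap : ∀ v : ℝ → ℝ≥0∞, IsRepulsiveFiniteRange v → ∃ ρ₁ : ℝ, 0 < ρ₁ ∧ ∀ ρ : ℝ, 0 < ρ → ρ < ρ₁ →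
      ∀ τ : ℝ, 0 < τ → ∃ κ : ℝ, 0 < κ ∧ ∀ᶠ N : ℕ in atTop, ∀ lam : ℝ, 0 < lam →
        lam ≤ κ / sideLength ρ N ^ 2 →
          TwoChord v N (sideLength ρ N) lam (κ / sideLength ρ N ^ 2) τ)
    (hbulk : ∀ v : ℝ → ℝ≥0∞, IsRepulsiveFiniteRange v → ∃ ρ₁ : ℝ, 0 < ρ₁ ∧ ∀ ρ : ℝ, 0 < ρ → ρ < ρ₁ →
      ∀ τ : ℝ, 0 < τ → ∀ κ : ℝ, 0 < κ → ∃ lam₀ : ℝ, 0 < lam₀ ∧ ∀ᶠ N : ℕ in atTop,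
        κ / sideLength ρ N ^ 2 ≤ lam₀ ∧ ∀ lam : ℝ, κ / sideLength ρ N ^ 2 ≤ lam → lam ≤ lam₀ →
          TwoChord v N (sideLength ρ N) lam lam₀ τ) :
    ∀ v : ℝ → ENNReal, Literature.MathematicalPhysics.QuantumManyBody.BoseGas.IsRepulsiveFiniteRange v → ∃ ρ₁ : ℝ, 0 < ρ₁ ∧ ∀ ρ : ℝ, 0 < ρ → ρ < ρ₁ → ∀ τ : ℝ, 0 < τ → ∃ lam₀ : ℝ, 0 < lam₀ ∧ ∀ᶠ N : ℕ in Filter.atTop, ∀ lam : ℝ, 0 < lam → lam ≤ lam₀ → (⨅ Ψ : Literature.MathematicalPhysics.QuantumManyBody.BoseGas.TrialState N (Literature.MathematicalPhysics.QuantumManyBody.BoseGas.sideLength ρ N), Literature.MathematicalPhysics.QuantumManyBody.BoseGas.energy v Ψ + ENNReal.ofReal lam * ((N : ENNReal) - Literature.MathematicalPhysics.QuantumManyBody.BoseGas.maxOccupation N Ψ.ψ)) + ENNReal.ofReal (lam / lam₀) * Literature.MathematicalPhysics.QuantumManyBody.BoseGas.groundStateEnergy v N (Literature.MathematicalPhysics.QuantumManyBody.BoseGas.sideLength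 ρ N) ≤ Literature.MathematicalPhysics.QuantumManyBody.BoseGas.groundStateEnergy v N (Literature.MathematicalPhysics.QuantumManyBody.BoseGas.sideLength ρ N) + ENNReal.ofReal (lam / lam₀) * (⨅ Ψ : Literature.MathematicalPhysics.QuantumManyBody.BoseGas.TrialState N (Literature.MathematicalPhysics.QuantumManyBody.BoseGas.sideLength ρ N), Literature.MathematicalPhysics.QuantumManyBody.BoseGas.energy v Ψ + ENNReal.ofReal lam₀ * ((N : ENNReal) - Literature.MathematicalPhysics.QuantumManyBody.BoseGas.maxOccupation N Ψ.ψ)) + ENNReal.ofReal (lam * τ * N) := by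
  intro v hv
  obtain ⟨ρg, hρg, Hg⟩ := hgap v hv
  obtain ⟨ρb, hρb, Hb⟩ := hbulk v hv
  refine ⟨min ρg ρb, lt_min hρg hρb, fun ρ hρ hlt τ hτ => ?_⟩
  obtain ⟨κ, hκ, hevg⟩ := Hg ρ hρ (hlt.trans_le (min_le_left _ _)) (τ / 2) (half_pos hτ)
  obtain ⟨lam₀, hlam₀, hevb⟩ := Hb ρ hρ (hlt.trans_le (min_le_right _ _)) (τ / 2) (half_pos hτ) κ hκ
  refine ⟨lam₀, hlam₀, ?_⟩
  filter_upwards [hevg, hevb, eventually_gt_atTop 0] with N hg hb hNpos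
  intro lam hlam hle
  -- the finite-size reward `m = κ / L_N²`
  have hL : 0 < sideLength ρ N := by
    unfold sideLength
    exact Real.rpow_pos_of_pos (div_pos (Nat.cast_pos.mpr hNpos) hρ) _
  have hm : 0 < κ / sideLength ρ N ^ 2 := div_pos hκ (pow_pos hL 2)
  show TwoChord v N (sideLength ρ N) lam lam₀ τ
  by_cases hcase : κ / sideLength ρ N ^ 2 ≤ lam
  · exact twoChord_mono_tau hlam.le (by linarith) (hb.2 lam hcase hle)
  · have hlt' : lam ≤ κ / sideLength ρ N ^ 2 := (lt_of_not_ge hcase).le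
    have h1 := hg lam hlam hlt'
    have h2 := hb.2 (κ / sideLength ρ N ^ 2) le_rfl hb.1
    simpa only [add_halves] using
      twoChord_concat hlam hlt' hb.1 (half_pos hτ).le (half_pos hτ).le h1 h2

end Summit.AtomisticToContinuum.BoseEinsteinCondensation.ModeFreeReward.BirthX1

end
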